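import Literature.NumberTheory.ComplexMultiplication.CMTypeRank
import HarnessLib

/-!
# Kubota's character formula for the rank of a CM type of an abelian CM field (Gordon Prop. 9.4.1):
# `rank(Φ) = 1 + #{χ odd : Σ_{s∈Φ} χ(s) ≠ 0}`, i.e. the defect is the number of odd characters vanishing on `Φ`

Companion of `CMTypeRank.lean` (abstract setting: a group acting on the embeddings, `typeRank`, `IsCMTypeWith`).
Here the group is a finite COMMUTATIVE group `G` acting on ITSELF by translation — the case of an abelian CM field
`K`, where `Hom(K, ℂ)` is a torsor under `G = Gal(K/ℚ)` ("identifying `Gal(K/ℚ)` with `(ℤ/Nℤ)ˣ`", Gordon 9.4.2) — and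
the theorem PROVED is T. Kubota, *On the field extension by complex multiplication*, Trans. AMS 118 (1965), **Lemma
2** (p. 119; held text `paper:doi-10-1090-s0002-9947-1965-0190144-8`, p0007 L13–L16):

> "LEMMA 2. Let `(F; {σᵢ})` be a CM-type such that `F/ℚ` is an abelian extension. Denote by `G` the Galois group of
> `F/ℚ`, and by `ρ ∈ G` the complex conjugation of `F`. Then, the defect of `(F; {σᵢ})` is equal to the number of
> characters `ψ` of `G` satisfying `Σᵢ ψ(σᵢ) = 0`, `ψ(ρ) = −1`."

("defect" = `m + 1 − rank`, Kubota §4 p. 118), in the equivalent form printed by B. B. Gordon, *A survey of the Hodge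
conjecture for abelian varieties*, **Proposition 9.4.1** ([B.60]) (held text `paper:arxiv-alg-geom_9709030` p0025
L58–L65): "`rank(K, S) = 1 + #{χ : Gal(K/ℚ) → ℂ : χ(c) = −1 & Σ_{s∈S} χ(s) ≠ 0}`".  This is the tool by which
"all of these examples [Ribet's, Lenstra's, Serre's degenerate types] are verified in [B.92] … exhibiting odd
characters `χ` such that `Σ_{s∈S} χ(s) = 0`" (Gordon 9.4.2).

## Statement and proof

For `G` a finite commutative group, `ρ ∈ G`, `Φ ⊆ G` with `IsCMTypeWith ρ Φ` (so `ρ² = 1 ≠ ρ`, `G = Φ ⊔ ρΦ`), and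
characters `χ : AddChar (Additive G) ℂ` (Mathlib's complex characters of the finite abelian group `G`):

* `IsCMTypeWith.typeRank_eq_one_add_card_oddCharacters` — **Kubota's Lemma 2 / Gordon 9.4.1**:
  `typeRank G Φ = 1 + #{χ | χ(ρ) = −1 ∧ Σ_{s∈Φ} χ(s) ≠ 0}`.

Proof (Kubota's, in the language of Fourier analysis on `G`): (1) the rank of the `ℚ`-span of the translates
`𝟙_{g⁻¹Φ}` equals the dimension of their `ℂ`-span (`ℚ → ℂ` base change of linear independence, Mathlib
`linearIndependent_algebraMap_comp_iff`); (2) in `ℂ^G` the translates expand in the character basis as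
`𝟙_{g⁻¹Φ} = Σ_χ ĉ(χ) χ(g) χ` with `ĉ(χ) = |G|⁻¹ Σ_{s∈Φ} χ(s)⁻¹`, so their span is contained in the span of the
characters with `ĉ(χ) ≠ 0`, and conversely `Σ_g χ₀(g)⁻¹ 𝟙_{g⁻¹Φ} = |G| ĉ(χ₀) χ₀` puts every such character in the
span (orthogonality `Σ_g χ(g) = |G|[χ = 1]`); characters being linearly independent, `rank = #{χ : ĉ(χ) ≠ 0}`;
(3) `ĉ(1) = ½ ≠ 0`; for even `χ ≠ 1` (`χ(ρ) = 1`), `0 = Σ_G χ = Σ_Φ χ + Σ_{ρΦ} χ = 2 Σ_Φ χ`, so `ĉ(χ) = 0`; for odd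
`χ`, `ĉ(χ) ≠ 0 ⟺ Σ_{s∈Φ} χ̄(s) ≠ 0 ⟺ Σ_{s∈Φ} χ(s) ≠ 0` (reindex by `χ ↦ χ̄`, which preserves oddness).

Everything is PROVED; no definition besides the private Fourier coefficient, no named fact, no `sorry`.  NOT here:
non-abelian Galois CM fields (Gordon's "only irreducible `χ`" — Kubota's Lemma 2 is the abelian case); the
number-field dress (identification `Hom(K, ℂ) ≅ Gal(K/ℚ)`-torsor); Leopoldt's Lemma 3 of Kubota (non-vanishing of
`Σ_{a=1}^{m} ψ(a)` from the class number formula), hence the nondegeneracy of the hyperelliptic Fermat quotients.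

## Sources

* T. Kubota, Trans. Amer. Math. Soc. 118 (1965) 113–122 [Kubota1965] (held), §4, Lemma 2 (p. 119), quoted above;
  defect: p. 118 ("We call the difference `m + 1 − rank(F; {φᵢ})` the defect").
* B. B. Gordon, *A survey of the Hodge conjecture for abelian varieties* [Gordon1999HodgeAVSurvey] (held),
  Proposition 9.4.1 ([B.60]) (p0025 L58–L65) and 9.4.2 (p0025 L116–L118), quoted above.
-/

set_option autoImplicit false

noncomputable section

open scoped BigOperators

namespace Literature.NumberTheory.ComplexMultiplication

/-! ### `ℚ → ℂ` base change of the span of finitely many rational vectors -/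

section BaseChange

variable {E : Type*} [Fintype E]

/-- Coordinatewise `ℚ → ℂ` on `ℚ^E`, as a `ℚ`-linear map. [folklore] -/
private def toComplexFun : (E → ℚ) →ₗ[ℚ] (E → ℂ) where
  toFun f x := (f x : ℂ)
  map_add' f f' := by funext x; simp
  map_smul' c f := by
    funext x
    simp only [Pi.smul_apply, smul_eq_mul, RingHom.id_apply, Rat.cast_mul, Rat.smul_def]

omit [Fintype E] in
/-- `toComplexFun f x = f x`. [folklore] -/
private theorem toComplexFun_apply (f : E → ℚ) (x : E) : toComplexFun f x = (f x : ℂ) := rfl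

omit [Fintype E] in
/-- `toComplexFun f = algebraMap ℚ ℂ ∘ f`. [folklore] -/
private theorem toComplexFun_eq_comp (f : E → ℚ) : toComplexFun f = (algebraMap ℚ ℂ) ∘ f := by
  funext x; simp [toComplexFun_apply]

/-- **The dimension of a span of rational vectors does not change under `ℚ → ℂ`**: for finitely many
`vᵢ ∈ ℚ^E`, `dim_ℂ span_ℂ{vᵢ} = dim_ℚ span_ℚ{vᵢ}` (the rank of a rational matrix is the same over `ℚ` and over
`ℂ`; Kubota: "the dimension of `P(G)^Φ` over `R` is equal to the rank", Lemma 1). [cite: Kubota1965, §2 Lemma 1] -/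
theorem finrank_span_range_ratCast_eq {ι : Type*} [Fintype ι] (v : ι → E → ℚ) :
    Module.finrank ℂ (Submodule.span ℂ (Set.range fun i => fun x => (v i x : ℂ))) =
      Module.finrank ℚ (Submodule.span ℚ (Set.range v)) := by
  classical
  obtain ⟨b, hb_sub, hb_span, hb_li⟩ := exists_linearIndependent ℚ (Set.range v)
  have hbfin : b.Finite := (Set.finite_range v).subset hb_sub
  haveI : Fintype b := hbfin.fintype
  -- `ℚ` side
  have h1 : Module.finrank ℚ (Submodule.span ℚ (Set.range v)) = Fintype.card b := by
    rw [← hb_span]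
    have := finrank_span_eq_card (R := ℚ) (b := ((↑) : b → E → ℚ)) hb_li
    rwa [Subtype.range_coe_subtype, Set.setOf_mem_eq] at this
  -- `ℂ` side: the family `w = toComplexFun ∘ (↑) : b → ℂ^E` is `ℂ`-linearly independent
  let w : b → E → ℂ := fun i => (algebraMap ℚ ℂ) ∘ (i : E → ℚ)
  have hw_li : LinearIndependent ℂ w := linearIndependent_algebraMap_comp_iff.2 hb_li
  have hw_eq : ∀ i : b, w i = toComplexFun (i : E → ℚ) := fun i => (toComplexFun_eq_comp _).symm
  have hrange : (Set.range fun i => fun x => (v i x : ℂ)) = toComplexFun '' Set.range v := by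
    ext f
    simp only [Set.mem_range, Set.mem_image, exists_exists_eq_and]
    constructor
    · rintro ⟨i, rfl⟩; exact ⟨i, rfl⟩
    · rintro ⟨i, rfl⟩; exact ⟨i, rfl⟩
  have hwrange : Set.range w = toComplexFun '' b := by
    ext f
    simp only [Set.mem_range, Set.mem_image, hw_eq]
    constructor
    · rintro ⟨i, rfl⟩; exact ⟨i, i.2, rfl⟩
    · rintro ⟨g, hg, rfl⟩; exact ⟨⟨g, hg⟩, rfl⟩
  have h2 : Submodule.span ℂ (Set.range fun i => fun x => (v i x : ℂ)) = Submodule.span ℂ (Set.range w) := by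
    rw [hrange, hwrange]
    refine le_antisymm (Submodule.span_le.2 ?_) (Submodule.span_mono (Set.image_mono hb_sub))
    rintro _ ⟨f, hf, rfl⟩
    -- `f ∈ span_ℚ (range v) = span_ℚ b`, so `toComplexFun f ∈ span_ℚ (toComplexFun '' b) ≤ span_ℂ (…)`
    have hf' : f ∈ Submodule.span ℚ b := by rw [hb_span]; exact Submodule.subset_span hf
    have h3 : toComplexFun f ∈ Submodule.span ℚ (toComplexFun '' b) := by
      rw [← Submodule.map_span]; exact Submodule.mem_map_of_mem hf'
    exact Submodule.span_le_restrictScalars ℚ ℂ _ h3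
  rw [h2, finrank_span_eq_card hw_li, h1]

end BaseChange

/-! ### Characters of a finite commutative group and the translates of a type -/

section Characters

open AddChar

variable {G : Type*} [CommGroup G] [Fintype G] [DecidableEq G]

/-- A character of `G`, as a complex function on `G` (through `Additive G`). [folklore] -/
private def charFun (χ : AddChar (Additive G) ℂ) : G → ℂ := fun x => χ (Additive.ofMul x)

omit [Fintype G] [DecidableEq G] in
/-- `charFun χ x = χ(x)`. [folklore] -/
private theorem charFun_apply (χ : AddChar (Additive G) ℂ) (x : G) : charFun χ x = χ (Additive.ofMul x) := rfl

omit [Fintype G] [DecidableEq G] in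
/-- `χ(xy) = χ(x)χ(y)`. [folklore] -/
private theorem charFun_mul (χ : AddChar (Additive G) ℂ) (x y : G) :
    charFun χ (x * y) = charFun χ x * charFun χ y := by
  simp only [charFun_apply, ofMul_mul, map_add_eq_mul]

omit [Fintype G] [DecidableEq G] in
/-- `χ(x⁻¹) χ(x) = 1`. [folklore] -/
private theorem charFun_inv_mul (χ : AddChar (Additive G) ℂ) (x : G) : charFun χ x⁻¹ * charFun χ x = 1 := by
  rw [← charFun_mul, inv_mul_cancel, charFun_apply, ofMul_one, map_zero_eq_one]

omit [Fintype G] [DecidableEq G] in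
/-- `χ(x) ≠ 0`. [folklore] -/
private theorem charFun_ne_zero (χ : AddChar (Additive G) ℂ) (x : G) : charFun χ x ≠ 0 := fun h => by
  have := charFun_inv_mul χ x
  rw [h, mul_zero] at this
  exact zero_ne_one this

omit [DecidableEq G] in
/-- The characters, as functions on `G`, are linearly independent over `ℂ` (Dedekind/Artin; Mathlib
`AddChar.linearIndependent`). [folklore] -/
private theorem linearIndependent_charFun : LinearIndependent ℂ (charFun (G := G)) :=
  AddChar.linearIndependent (Additive G) ℂ

omit [DecidableEq G] in
/-- Orthogonality of characters: `Σ_g χ(g) = |G|` if `χ = 1`, else `0` (Mathlib `AddChar.sum_eq_ite`). [folklore] -/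
private theorem sum_charFun_eq_ite (χ : AddChar (Additive G) ℂ) :
    ∑ g : G, charFun χ g = if χ = 0 then (Fintype.card G : ℂ) else 0 := by
  classical
  have h := AddChar.sum_eq_ite χ
  have hc : Fintype.card (Additive G) = Fintype.card G := Fintype.card_congr Additive.toMul
  rw [hc] at h
  rw [← h]
  exact Fintype.sum_equiv Additive.ofMul _ _ fun x => rfl

/-- Dual orthogonality: `Σ_χ χ(x) = |G|` if `x = 1`, else `0` (Mathlib `AddChar.sum_apply_eq_ite`). [folklore] -/
private theorem sum_charFun_apply_eq_ite (x : G) :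
    ∑ χ : AddChar (Additive G) ℂ, charFun χ x = if x = 1 then (Fintype.card G : ℂ) else 0 := by
  classical
  have h := AddChar.sum_apply_eq_ite (α := Additive G) (Additive.ofMul x)
  simp only [charFun_apply]
  have hc : Fintype.card (Additive G) = Fintype.card G := Fintype.card_congr Additive.toMul
  rw [h, hc]
  by_cases hx : x = 1
  · subst hx; simp
  · rw [if_neg hx, if_neg]
    exact fun h' => hx (Additive.ofMul.injective (by rw [h']; rfl))

variable (Φ : Finset G)

/-- Kubota's Fourier coefficient of the type: `ĉ(χ) = |G|⁻¹ Σ_{s∈Φ} χ(s)⁻¹` (so that `𝟙_Φ = Σ_χ ĉ(χ) χ`). [cite: Kubota1965, §4 Lemma 2 (proof)] -/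
private def coeff (χ : AddChar (Additive G) ℂ) : ℂ := (Fintype.card G : ℂ)⁻¹ * ∑ s ∈ Φ, charFun χ s⁻¹

/-- The translate `x ↦ [g x ∈ Φ]` as a complex function. [cite: Kubota1965, §4 Lemma 2 (proof)] -/
private def translateC (g : G) : G → ℂ := fun x => (translateInd (Φ : Set G) g x : ℂ)

/-- **Fourier expansion of a translate**: `[gx ∈ Φ] = Σ_χ ĉ(χ) χ(g) χ(x)`.  Indeed
`Σ_χ ĉ(χ)χ(gx) = |G|⁻¹ Σ_{s∈Φ} Σ_χ χ(g x s⁻¹) = Σ_{s∈Φ} [gx = s]`. [cite: Kubota1965, §4 Lemma 2 (proof)] -/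
private theorem translateC_eq_sum (g : G) :
    translateC Φ g = ∑ χ : AddChar (Additive G) ℂ, (coeff Φ χ * charFun χ g) • charFun χ := by
  classical
  funext x
  simp only [translateC, Finset.sum_apply, Pi.smul_apply, smul_eq_mul, coeff]
  have hcard : (Fintype.card G : ℂ) ≠ 0 := Nat.cast_ne_zero.2 Fintype.card_ne_zero
  -- rewrite each summand as `|G|⁻¹ Σ_{s∈Φ} χ(g x s⁻¹)`
  have h1 : ∀ χ : AddChar (Additive G) ℂ, (Fintype.card G : ℂ)⁻¹ * (∑ s ∈ Φ, charFun χ s⁻¹) * charFun χ g *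
      charFun χ x = (Fintype.card G : ℂ)⁻¹ * ∑ s ∈ Φ, charFun χ (g * x * s⁻¹) := by
    intro χ
    rw [Finset.mul_sum, Finset.mul_sum, Finset.sum_mul, Finset.sum_mul]
    refine Finset.sum_congr rfl fun s _ => ?_
    rw [charFun_mul, charFun_mul]; ring
  simp_rw [h1]
  rw [← Finset.mul_sum, Finset.sum_comm]
  simp_rw [sum_charFun_apply_eq_ite]
  -- `Σ_{s∈Φ} [g x s⁻¹ = 1] |G| = |G| [gx ∈ Φ]`
  have h2 : ∑ s ∈ Φ, (if g * x * s⁻¹ = 1 then (Fintype.card G : ℂ) else 0) =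
      if g * x ∈ Φ then (Fintype.card G : ℂ) else 0 := by
    have h3 : ∀ s : G, (g * x * s⁻¹ = 1) ↔ s = g * x := fun s => by
      rw [mul_inv_eq_one]; exact eq_comm
    simp_rw [h3]
    rw [Finset.sum_ite_eq' Φ (g * x)]
  rw [h2]
  by_cases hgx : g * x ∈ Φ
  · have : g • x ∈ (Φ : Set G) := by simpa using hgx
    rw [if_pos hgx, translateInd_of_mem this, inv_mul_cancel₀ hcard]; simp
  · have : g • x ∉ (Φ : Set G) := by simpa using hgx
    rw [if_neg hgx, translateInd_of_not_mem this, mul_zero]; simp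

/-- Every translate lies in the span of the characters with `ĉ(χ) ≠ 0`. [cite: Kubota1965, §4 Lemma 2 (proof)] -/
private theorem translateC_mem_span (g : G) :
    translateC Φ g ∈ Submodule.span ℂ (charFun '' {χ : AddChar (Additive G) ℂ | coeff Φ χ ≠ 0}) := by
  rw [translateC_eq_sum]
  refine Submodule.sum_mem _ fun χ _ => ?_
  by_cases hχ : coeff Φ χ = 0
  · rw [hχ, zero_mul, zero_smul]; exact Submodule.zero_mem _
  · exact Submodule.smul_mem _ _ (Submodule.subset_span ⟨χ, hχ, rfl⟩)

/-- **Conversely**: `Σ_g χ₀(g⁻¹) [g x ∈ Φ] = |G| ĉ(χ₀) χ₀(x)`, so every character with `ĉ(χ₀) ≠ 0` is a combination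
of translates. [cite: Kubota1965, §4 Lemma 2 (proof)] -/
private theorem sum_charFun_inv_smul_translateC (χ₀ : AddChar (Additive G) ℂ) :
    ∑ g : G, charFun χ₀ g⁻¹ • translateC Φ g = ((Fintype.card G : ℂ) * coeff Φ χ₀) • charFun χ₀ := by
  classical
  simp_rw [translateC_eq_sum, Finset.smul_sum, smul_smul]
  rw [Finset.sum_comm]
  -- inner sum over `g`: `Σ_g χ₀(g⁻¹) ĉ(χ) χ(g) = ĉ(χ) Σ_g (χ − χ₀)(g)`
  have h1 : ∀ χ : AddChar (Additive G) ℂ, ∑ g : G, (charFun χ₀ g⁻¹ * (coeff Φ χ * charFun χ g)) • charFun χ =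
      (coeff Φ χ * ∑ g : G, charFun (χ - χ₀) g) • charFun χ := by
    intro χ
    rw [← Finset.sum_smul, Finset.mul_sum]
    congr 1
    refine Finset.sum_congr rfl fun g _ => ?_
    rw [charFun_apply, charFun_apply, charFun_apply, AddChar.sub_apply, ofMul_inv]
    ring
  simp_rw [h1, sum_charFun_eq_ite, sub_eq_zero]
  rw [Finset.sum_eq_single χ₀]
  · rw [if_pos rfl]; ring_nf
  · intro χ _ hne
    rw [if_neg hne, mul_zero, zero_smul]
  · intro h; exact absurd (Finset.mem_univ χ₀) h

/-- **The `ℂ`-span of the translates is the span of the characters with `ĉ(χ) ≠ 0`.** [cite: Kubota1965, §4 Lemma 2 (proof)] -/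
private theorem span_translateC_eq :
    Submodule.span ℂ (Set.range (translateC Φ)) =
      Submodule.span ℂ (charFun '' {χ : AddChar (Additive G) ℂ | coeff Φ χ ≠ 0}) := by
  refine le_antisymm (Submodule.span_le.2 ?_) (Submodule.span_le.2 ?_)
  · rintro _ ⟨g, rfl⟩
    exact translateC_mem_span Φ g
  · rintro _ ⟨χ₀, hχ₀, rfl⟩
    have hcard : (Fintype.card G : ℂ) ≠ 0 := Nat.cast_ne_zero.2 Fintype.card_ne_zero
    have hc : (Fintype.card G : ℂ) * coeff Φ χ₀ ≠ 0 := mul_ne_zero hcard hχ₀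
    have hmem : ((Fintype.card G : ℂ) * coeff Φ χ₀) • charFun χ₀ ∈ Submodule.span ℂ (Set.range (translateC Φ)) := by
      rw [← sum_charFun_inv_smul_translateC]
      exact Submodule.sum_mem _ fun g _ => Submodule.smul_mem _ _ (Submodule.subset_span ⟨g, rfl⟩)
    have := Submodule.smul_mem _ ((Fintype.card G : ℂ) * coeff Φ χ₀)⁻¹ hmem
    rwa [smul_smul, inv_mul_cancel₀ hc, one_smul] at this

/-- **`rank(Φ) = #{χ : ĉ(χ) ≠ 0}`** (characters are linearly independent). [cite: Kubota1965, §4 Lemma 2 (proof)] -/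
private theorem typeRank_eq_ncard_coeff_ne_zero :
    typeRank G (Φ : Set G) = {χ : AddChar (Additive G) ℂ | coeff Φ χ ≠ 0}.ncard := by
  classical
  rw [typeRank_eq_finrank_translateSpan, translateSpan]
  have h1 := finrank_span_range_ratCast_eq (E := G) (fun g : G => translateInd (Φ : Set G) g)
  rw [← h1]
  change Module.finrank ℂ (Submodule.span ℂ (Set.range (translateC Φ))) = _
  rw [span_translateC_eq]
  set C : Set (AddChar (Additive G) ℂ) := {χ | coeff Φ χ ≠ 0} with hC
  haveI : Fintype C := Fintype.ofFinite C
  have hli : LinearIndependent ℂ (fun χ : C => charFun (χ : AddChar (Additive G) ℂ)) :=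
    linearIndependent_charFun.comp _ Subtype.val_injective
  have hr : charFun '' C = Set.range (fun χ : C => charFun (χ : AddChar (Additive G) ℂ)) := by
    ext f; simp only [Set.mem_image, Set.mem_range, Subtype.exists, exists_prop]
  rw [hr, finrank_span_eq_card hli, Set.ncard_eq_toFinset_card', Set.toFinset_card]

end Characters

/-! ### Kubota's Lemma 2: the coefficients of a CM type -/

section Kubota

open AddChar

variable {G : Type*} [CommGroup G] [Fintype G] [DecidableEq G] {ρ : G} {Φ : Finset G}

omit [Fintype G] [DecidableEq G] in
/-- `χ(s⁻¹) = χ̄(s)`, `χ̄ = −χ` the inverse character. [folklore] -/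
private theorem charFun_inv_eq_neg (χ : AddChar (Additive G) ℂ) (s : G) : charFun χ s⁻¹ = charFun (-χ) s := by
  rw [charFun_apply, charFun_apply, AddChar.neg_apply, ofMul_inv]

omit [DecidableEq G] in
/-- `ĉ(χ) = |G|⁻¹ Σ_{s∈Φ} χ̄(s)`. [cite: Kubota1965, §4 Lemma 2 (proof)] -/
private theorem coeff_eq (χ : AddChar (Additive G) ℂ) :
    coeff Φ χ = (Fintype.card G : ℂ)⁻¹ * ∑ s ∈ Φ, charFun (-χ) s := by
  simp only [coeff, charFun_inv_eq_neg]

namespace IsCMTypeWith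

variable (h : IsCMTypeWith ρ (Φ : Set G))
include h

omit [Fintype G] [DecidableEq G] in
/-- `ρ² = 1`. [folklore] -/
private theorem rho_mul_rho : ρ * ρ = 1 := by
  have := h.invol (1 : G)
  simpa [smul_eq_mul] using this

omit [Fintype G] [DecidableEq G] in
/-- `ρx ∈ Φ ↔ x ∉ Φ`. [folklore] -/
private theorem rho_mul_mem_iff (x : G) : ρ * x ∈ Φ ↔ x ∉ Φ := by
  have := h.rho_smul_mem_iff x
  simpa [smul_eq_mul] using this

/-- `Φᶜ = ρΦ` as finite sets (`G = Φ ⊔ ρΦ`). [folklore] -/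
private theorem compl_eq_image : Φᶜ = Φ.image fun s => ρ * s := by
  ext x
  simp only [Finset.mem_compl, Finset.mem_image]
  constructor
  · intro hx
    refine ⟨ρ * x, (h.rho_mul_mem_iff x).2 hx, ?_⟩
    rw [← mul_assoc, h.rho_mul_rho, one_mul]
  · rintro ⟨s, hs, rfl⟩ hρs
    exact (h.rho_mul_mem_iff s).1 hρs hs

/-- `Σ_{x∈G} f(x) = Σ_{s∈Φ} f(s) + Σ_{s∈Φ} f(ρs)`. [folklore] -/
private theorem sum_univ_eq (f : G → ℂ) : ∑ x, f x = ∑ s ∈ Φ, f s + ∑ s ∈ Φ, f (ρ * s) := by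
  rw [← Finset.sum_add_sum_compl Φ f, h.compl_eq_image, Finset.sum_image]
  intro a _ b _ hab
  exact mul_left_cancel hab

omit [Fintype G] [DecidableEq G] in
/-- `Φ` is non-empty (it contains `1` or `ρ`). [folklore] -/
private theorem nonempty : Φ.Nonempty := by
  by_cases h1 : (1 : G) ∈ Φ
  · exact ⟨1, h1⟩
  · refine ⟨ρ, ?_⟩
    have := (h.rho_mul_mem_iff 1).2 h1
    rwa [mul_one] at this

omit [Fintype G] [DecidableEq G] in
/-- `χ(ρ) = ±1`. [folklore] -/
private theorem charFun_rho (χ : AddChar (Additive G) ℂ) : charFun χ ρ = 1 ∨ charFun χ ρ = -1 := by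
  have h1 : charFun χ ρ * charFun χ ρ = 1 := by
    rw [← charFun_mul, h.rho_mul_rho, charFun_apply, ofMul_one, map_zero_eq_one]
  exact mul_self_eq_one_iff.1 h1

omit [Fintype G] [DecidableEq G] in
/-- `(−χ)(ρ) = χ(ρ)` (`ρ = ρ⁻¹`). [folklore] -/
private theorem charFun_neg_rho (χ : AddChar (Additive G) ℂ) : charFun (-χ) ρ = charFun χ ρ := by
  rw [← charFun_inv_eq_neg]
  congr 1
  rw [inv_eq_iff_mul_eq_one, h.rho_mul_rho]

/-- **Even non-trivial characters vanish on `Φ`**: `0 = Σ_G χ = Σ_Φ χ + χ(ρ) Σ_Φ χ = 2 Σ_Φ χ`.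
[cite: Kubota1965, §4 Lemma 2 (proof)] -/
private theorem sum_charFun_eq_zero_of_even {χ : AddChar (Additive G) ℂ} (hχ : χ ≠ 0)
    (heven : charFun χ ρ = 1) : ∑ s ∈ Φ, charFun χ s = 0 := by
  classical
  have h1 := sum_charFun_eq_ite χ
  rw [if_neg hχ, h.sum_univ_eq] at h1
  simp only [charFun_mul, heven, one_mul] at h1
  linear_combination h1 / 2

omit [DecidableEq G] in
/-- `ĉ(1) ≠ 0` (`= |Φ|/|G| = ½`). [cite: Kubota1965, §4 Lemma 2 (proof)] -/
private theorem coeff_zero_ne_zero : coeff Φ (0 : AddChar (Additive G) ℂ) ≠ 0 := by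
  rw [coeff_eq, neg_zero]
  simp only [charFun_apply, AddChar.zero_apply, Finset.sum_const, nsmul_eq_mul, mul_one]
  refine mul_ne_zero (inv_ne_zero (Nat.cast_ne_zero.2 Fintype.card_ne_zero)) ?_
  exact Nat.cast_ne_zero.2 (Finset.card_ne_zero.2 h.nonempty)

/-- **The characters with `ĉ(χ) ≠ 0` are the trivial one and the conjugates of the odd characters not vanishing on
`Φ`.** [cite: Kubota1965, §4 Lemma 2 (proof)] -/
private theorem setOf_coeff_ne_zero_eq :
    {χ : AddChar (Additive G) ℂ | coeff Φ χ ≠ 0} =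
      insert 0 ((fun χ => -χ) '' {χ : AddChar (Additive G) ℂ | charFun χ ρ = -1 ∧ ∑ s ∈ Φ, charFun χ s ≠ 0}) := by
  have hcard : (Fintype.card G : ℂ)⁻¹ ≠ 0 := inv_ne_zero (Nat.cast_ne_zero.2 Fintype.card_ne_zero)
  ext χ
  simp only [Set.mem_setOf_eq, Set.mem_insert_iff, Set.mem_image]
  constructor
  · intro hc
    by_cases h0 : χ = 0
    · exact Or.inl h0
    · refine Or.inr ⟨-χ, ⟨?_, ?_⟩, neg_neg χ⟩
      · -- `χ` is odd: an even non-trivial `χ` would have `ĉ(χ) = 0`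
        rw [h.charFun_neg_rho]
        rcases h.charFun_rho χ with he | ho
        · exfalso
          apply hc
          rw [coeff_eq, h.sum_charFun_eq_zero_of_even (neg_ne_zero.2 h0) (by rw [h.charFun_neg_rho, he]),
            mul_zero]
        · exact ho
      · intro hs
        apply hc
        rw [coeff_eq, hs, mul_zero]
  · rintro (rfl | ⟨ψ, ⟨hψρ, hψs⟩, rfl⟩)
    · exact h.coeff_zero_ne_zero
    · rw [coeff_eq, neg_neg]
      exact mul_ne_zero hcard hψs

/-- **Kubota's Lemma 2 (Gordon Proposition 9.4.1).**  For a CM type `Φ` of a finite commutative group `G` (acting on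
itself; `ρ` the complex conjugation):
`rank(Φ) = 1 + #{χ : G → ℂˣ | χ(ρ) = −1 and Σ_{s∈Φ} χ(s) ≠ 0}` — equivalently the defect
`|G|/2 + 1 − rank(Φ)` is the number of odd characters `χ` with `Σ_{s∈Φ} χ(s) = 0` ("the defect of `(F; {σᵢ})` is
equal to the number of characters `ψ` of `G` satisfying `Σᵢ ψ(σᵢ) = 0`, `ψ(ρ) = −1`").
[cite: Kubota1965, §4 Lemma 2] [cite: Gordon1999HodgeAVSurvey, §9.4.1 (Proposition [B.60])] -/
theorem typeRank_eq_one_add_ncard_oddCharacters :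
    typeRank G (Φ : Set G) =
      1 + {χ : AddChar (Additive G) ℂ | χ (Additive.ofMul ρ) = -1 ∧ ∑ s ∈ Φ, χ (Additive.ofMul s) ≠ 0}.ncard := by
  rw [typeRank_eq_ncard_coeff_ne_zero, h.setOf_coeff_ne_zero_eq]
  set T : Set (AddChar (Additive G) ℂ) := {χ | charFun χ ρ = -1 ∧ ∑ s ∈ Φ, charFun χ s ≠ 0} with hT
  have h0 : (0 : AddChar (Additive G) ℂ) ∉ (fun χ => -χ) '' T := by
    rintro ⟨ψ, ⟨hψρ, -⟩, hψ0⟩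
    have : ψ = 0 := neg_eq_zero.1 hψ0
    rw [this, charFun_apply, AddChar.zero_apply] at hψρ
    norm_num at hψρ
  rw [Set.ncard_insert_of_notMem h0 (Set.toFinite _), Set.ncard_image_of_injective T neg_injective, add_comm]
  rfl

/-- **The defect form** (Kubota's wording): `rank(Φ) + #{χ odd : Σ_{s∈Φ} χ(s) = 0} = |G|/2 + 1`, the odd characters
being `|G|/2` in number. [cite: Kubota1965, §4 Lemma 2] -/
theorem typeRank_add_ncard_oddCharacters_vanishing :
    typeRank G (Φ : Set G) +
        {χ : AddChar (Additive G) ℂ | χ (Additive.ofMul ρ) = -1 ∧ ∑ s ∈ Φ, χ (Additive.ofMul s) = 0}.ncard =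
      {χ : AddChar (Additive G) ℂ | χ (Additive.ofMul ρ) = -1}.ncard + 1 := by
  rw [h.typeRank_eq_one_add_ncard_oddCharacters]
  have hsplit := Set.ncard_inter_add_ncard_sdiff_eq_ncard
    {χ : AddChar (Additive G) ℂ | χ (Additive.ofMul ρ) = -1}
    {χ : AddChar (Additive G) ℂ | ∑ s ∈ Φ, χ (Additive.ofMul s) ≠ 0} (Set.toFinite _)
  have h1 : {χ : AddChar (Additive G) ℂ | χ (Additive.ofMul ρ) = -1} ∩
      {χ : AddChar (Additive G) ℂ | ∑ s ∈ Φ, χ (Additive.ofMul s) ≠ 0} =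
      {χ : AddChar (Additive G) ℂ | χ (Additive.ofMul ρ) = -1 ∧ ∑ s ∈ Φ, χ (Additive.ofMul s) ≠ 0} := by
    ext χ; simp only [Set.mem_inter_iff, Set.mem_setOf_eq]
  have h2 : {χ : AddChar (Additive G) ℂ | χ (Additive.ofMul ρ) = -1} \
      {χ : AddChar (Additive G) ℂ | ∑ s ∈ Φ, χ (Additive.ofMul s) ≠ 0} =
      {χ : AddChar (Additive G) ℂ | χ (Additive.ofMul ρ) = -1 ∧ ∑ s ∈ Φ, χ (Additive.ofMul s) = 0} := by
    ext χ; simp only [Set.mem_sdiff, Set.mem_setOf_eq, not_not]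
  rw [h1, h2] at hsplit
  omega

end IsCMTypeWith

end Kubota

end Literature.NumberTheory.ComplexMultiplication

end
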